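import Summits.CriticalPhenomena.PercolationContinuityZ3.Theorems.PercNearOneGluingNoHeavyLowerTailFKHullPortTASections
import Summits.CriticalPhenomena.PercolationContinuityZ3.Theorems.PercNearOneGluingNoHeavyLowerTailFKExitPairPosCorr
import Summits.CriticalPhenomena.PercolationContinuityZ3.Theorems.PercNearOneGluingNoHeavyLowerTailHullPortTABase
import HarnessLib

/-!
# FK sub-lane: tools for Lemma `Δ_N` for `φ_{𝐩,q}` — signs, vanishing, finite energy, two-exit positive correlation in `tab` form

Support file (`--supports stmt-CriticalPhenomena-4575`), FK sub-lane `prim-bschramm-fk-2` (gen 3); builds on p205010 (kernel theorem,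
internal audit signed; external expert review pending).  No definitions, no named facts, no sorries; standard axioms.

Part 1 (tools) of the Lean proof of THE LOCATED OPEN LEMMA OF THE FK FINITE LEG (lane VERDICT V40: "(Δ) = Lemma Δ_N for FK: Cov_{φ(·|C_y ∌ s,x)}(Ψ_{s,y,U}(C_x), ω_e) ≤ 0
for e = xv at x"), in the sum-level vocabulary of `…FKHullPortTADefs.lean` and for an avoided vertex SET `X` (bschramm/FK-Q2.md §12):
for `q ≥ 1`, a weight vector `w` whose weight-`1` pairs lie inside `X` (they encode earlier contractions), and a pair `e = s(a,b)`
touching `X` (`a ∈ X`) with `0 < w e < 1`,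
  `B(w[e↦1], X∪{b}) · b(w[e↦0], X) ≤ B(w[e↦0], X) · b(w[e↦1], X∪{b})`,
where `(w[e↦1], X∪{b})` is the honest contraction `G/e` and `(w[e↦0], X)` the deletion `G∖e`; i.e. contracting an edge at the avoided
set lowers `E[Ψ(C_X) | C_y ∌ s, C_y ∩ X = ∅]`.  The q = 1 proof (prim-hp-7 HP7-MDLX-PROOF §4, prove-5 `HullPort.deltaN_nonneg`) couples
`K₁ = K₀ ∪ C_v` on ONE product measure; for `q > 1` that coupling leaves a cross-measure term (FK-Q2 §11.3 (IIa)).  The FK proof uses NO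
coupling: a SECOND one-edge Bernstein deformation at another fractional pair `f` touching `X` makes the claim a quadratic in `w f` whose
endpoint coefficients and whose `B·b` cross factor are instances of the claim at smaller states, and whose other cross factor is the positive
correlation of `ω_e, ω_f` given avoidance (van den Berg–Häggström–Kahn Thm 2.1 for `φ_{𝐩,q}`); the single-fractional-pair case is prim-hp-7's
Lemma `P_v` for `φ_{𝐩,q}` after a Markov factorisation (vdBHK Lemma 2.3) and a constant tilt `q⁻¹`.

THIS FILE: `FK.taC_nonneg`/`FK.taB_nonneg` (FKG in the FK worlds, `q ≥ 1`), `FK.taB_eq_zero_of_root_mem`, `FK.taB_eq_zero_of_mem`, `FK.tab_eq_zero_of_mem`,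
`FK.tab_pos` (finite energy: the configuration of the weight-1 pairs), `FK.rcWeightW_split`, and `FK.tab_posCorr`: with `w_{ij} = w[e↦i][f↦j]`,
`b(w₀₁, X∪{d})·b(w₁₀, X∪{b}) ≤ b(w₀₀, X)·b(w₁₁, X∪{b,d})` — the cross-factor sign `(PC)`, from `FK.exitPair_posCorrelation_rc`.
[cite: VandenbergHaggstromKahn2005, Thm. 2.1 (p. 9); §1 pp. 3–5; §2.1 Lemmas 2.2–2.3 (p. 10)]
[cite: Grimmett2006, §1.4 eq. (1.20) (p. 15); Thm. (3.1)(a) (p. 37); Thm. (3.8)(b)]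
-/

noncomputable section

namespace Summit.CriticalPhenomena.PercolationContinuityZ3.Theorems.FK

open MeasureTheory Set Literature.Probability.LatticeModels Literature.Probability.Percolation
open Literature.Probability.Percolation.DecisionTree (ind ind_of_mem ind_of_not_mem ind_nonneg)
open Literature.Probability.Percolation.BHK2006 (rcMass delW)
open Summit.CriticalPhenomena.PercolationContinuityZ3.Theorems.HullPort (cut avoidEv)
open scoped Classical

variable {V : Type*} [Fintype V]

section DeltaN

open Literature.Probability.Percolation.BHK2006 (weight rcMass_fkg rcMass_nonneg openEdgeCluster_mono coe_delW)
open Summit.CriticalPhenomena.PercolationContinuityZ3.Theorems.HullPort (insert_mem_avoidEv_iff cut_insert_edge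
  edge_mem_cut eq_of_reachable_of_isolated mem_cut_of_mem bernstein_step bernstein_step_degenerate)

omit [Fintype V] in
/-- The indicator of an upper set is monotone. [folklore] -/
theorem monotone_ind_of_isUpperSet {α : Type*} [Preorder α] {A : Set α} (hA : IsUpperSet A) :
    Monotone (fun a => ind A a) := by
  intro a b hab
  show ind A a ≤ ind A b
  by_cases ha : a ∈ A
  · rw [ind_of_mem ha, ind_of_mem (hA hab ha)]
  · rw [ind_of_not_mem ha]
    exact ind_nonneg A b

/-- `c(ω) ≥ 0` for a monotone test function: FKG for the world measure `φ_{G − cut, q}`, `q ≥ 1`.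
[cite: Grimmett2006, Thm. (3.8)(b)] [cite: VandenbergHaggstromKahn2005, §2.1 Lemma 2.2 (p. 10)] -/
theorem taC_nonneg (w : Sym2 V → unitInterval) {q : ℝ} (hq : 1 ≤ q) (s y : V) (X : Set V) {g : Set (Sym2 V) → ℝ}
    (hg : Monotone g) (ω : Set (Sym2 V)) : 0 ≤ taC w q s y X g ω := by
  unfold taC wE
  have h := rcMass_fkg (delW w (cut X ω)) hq (f := fun η => g (openEdgeCluster η s))
    (g := fun η => ind (openConn s y) η) (fun a b hab => hg (openEdgeCluster_mono hab s))
    (monotone_ind_of_isUpperSet (isUpperSet_openConn s y))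
  linarith

/-- `B ≥ 0` for a monotone test function (`q ≥ 1`). [cite: Grimmett2006, Thm. (3.8)(b)] -/
theorem taB_nonneg (w : Sym2 V → unitInterval) {q : ℝ} (hq : 1 ≤ q) (s y : V) (X : Set V) {g : Set (Sym2 V) → ℝ}
    (hg : Monotone g) : 0 ≤ taB w q s y X g :=
  Finset.sum_nonneg fun ω _ => mul_nonneg (rcWeightW_nonneg w (zero_le_one.trans hq) ∅ ω)
    (mul_nonneg (ind_nonneg _ _) (taC_nonneg w hq s y X hg ω))

/-- `b ≥ 0`. [cite: Grimmett2006, §1.4 eq. (1.20) (p. 15)] -/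
theorem tab_nonneg (w : Sym2 V → unitInterval) {q : ℝ} (hq : 0 ≤ q) (s y : V) (X : Set V) : 0 ≤ tab w q s y X :=
  Finset.sum_nonneg fun ω _ => mul_nonneg (rcWeightW_nonneg w hq ∅ ω) (ind_nonneg _ _)

/-- If the root `s` lies in the avoided set then `B = 0` (`1{s ↮ X} ≡ 0`). [folklore] -/
theorem taB_eq_zero_of_root_mem (w : Sym2 V → unitInterval) (q : ℝ) (s y : V) (X : Set V) (hs : s ∈ X)
    (g : Set (Sym2 V) → ℝ) : taB w q s y X g = 0 := by
  unfold taB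
  refine Finset.sum_eq_zero fun ω _ => ?_
  have : ω ∉ avoidEv s X := fun h => h s hs (SimpleGraph.Reachable.refl _)
  rw [ind_of_not_mem this, zero_mul, mul_zero]

/-- If `y ∈ {s} ∪ X` then `b = 0`. [folklore] -/
theorem tab_eq_zero_of_mem (w : Sym2 V → unitInterval) (q : ℝ) (s y : V) (X : Set V) (hy : y ∈ insert s X) :
    tab w q s y X = 0 := by
  unfold tab
  refine Finset.sum_eq_zero fun ω _ => ?_
  have : ω ∉ avoidEv y (insert s X) := fun h => h y hy (SimpleGraph.Reachable.refl _)
  rw [ind_of_not_mem this, mul_zero]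

/-- In a world in which every pair at `y` is deleted, `{s ↔ y}` (`s ≠ y`) has probability `0`. [cite: VandenbergHaggstromKahn2005, §2.1 Lemma 2.3 (p. 10)] -/
theorem wE_mul_ind_openConn_eq_zero (w : Sym2 V → unitInterval) (q : ℝ) {B : Set (Sym2 V)} {s y : V} (hsy : s ≠ y)
    (hB : ∀ e : Sym2 V, y ∈ e → e ∈ B) (F : Set (Sym2 V) → ℝ) :
    wE w q B (fun η => F η * ind (openConn s y) η) = 0 := by
  unfold wE
  refine Finset.sum_eq_zero fun η _ => ?_
  by_cases hη : ∃ e ∈ η, e ∈ B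
  · obtain ⟨e, heη, heB⟩ := hη
    have h0 : ((delW w B e : unitInterval) : ℝ) = 0 := by rw [coe_delW, if_pos heB]
    have : rcMass (delW w B) q η = 0 := by
      unfold rcMass
      rw [rcWeightW_eq_zero_of_zero_mem (delW w B) q ∅ h0 heη, zero_div]
    rw [this, zero_mul]
  · have hiso : ∀ e ∈ η, y ∉ e := fun e he hye => hη ⟨e, he, hB e hye⟩
    have hns : η ∉ openConn s y := fun h => hsy (eq_of_reachable_of_isolated hiso s h.symm)
    show rcMass (delW w B) q η * (F η * ind (openConn s y) η) = 0
    rw [ind_of_not_mem hns, mul_zero, mul_zero]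

/-- If `y ∈ X` then `B = 0` (in every world `y` is isolated, so `c ≡ 0`). [folklore] -/
theorem taB_eq_zero_of_mem (w : Sym2 V → unitInterval) (q : ℝ) {s y : V} (hsy : s ≠ y) (X : Set V) (hy : y ∈ X)
    (g : Set (Sym2 V) → ℝ) : taB w q s y X g = 0 := by
  unfold taB
  refine Finset.sum_eq_zero fun ω _ => ?_
  have hC : taC w q s y X g ω = 0 := by
    unfold taC
    have h1 := wE_mul_ind_openConn_eq_zero w q hsy (B := cut X ω) (fun e hye => mem_cut_of_mem hy hye ω)
      (fun η => g (openEdgeCluster η s))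
    have h2 := wE_mul_ind_openConn_eq_zero w q hsy (B := cut X ω) (fun e hye => mem_cut_of_mem hy hye ω) (fun _ => 1)
    have h2' : wE w q (cut X ω) (ind (openConn s y)) = 0 := by
      rw [← h2]; unfold wE; simp only [one_mul]
    rw [h1, h2']
    ring
  rw [hC, mul_zero, mul_zero]

/-- **Positivity of `b`**: if every weight-`1` pair lies inside `X` and `y ∉ {s} ∪ X`, the configuration "exactly the
weight-`1` pairs open" has positive weight and isolates `y`. [cite: Grimmett2006, Thm. (3.1) eq. (3.4) (finite energy)] -/
theorem tab_pos (w : Sym2 V → unitInterval) {q : ℝ} (hq : 0 < q) {s y : V} (hsy : s ≠ y) (X : Set V)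
    (hINV : ∀ e : Sym2 V, ((w e : unitInterval) : ℝ) = 1 → ∀ a ∈ e, a ∈ X) (hyX : y ∉ X) : 0 < tab w q s y X := by
  classical
  unfold tab
  set ω₁ : BondConfig V := {e | ((w e : unitInterval) : ℝ) = 1} with hω₁
  have hterm : ∀ ω, 0 ≤ rcWeightW w q ∅ ω * ind (avoidEv y (insert s X)) ω := fun ω =>
    mul_nonneg (rcWeightW_nonneg w hq.le ∅ ω) (ind_nonneg _ _)
  refine lt_of_lt_of_le ?_ (Finset.single_le_sum (fun ω _ => hterm ω) (Finset.mem_univ ω₁))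
  have hmem : ω₁ ∈ avoidEv y (insert s X) := by
    intro t ht hyt
    have hiso : ∀ e ∈ ω₁, y ∉ e := fun e he hye => hyX (hINV e he y hye)
    have hty := eq_of_reachable_of_isolated hiso t hyt
    rw [hty] at ht
    rcases Set.mem_insert_iff.1 ht with h | h
    · exact hsy h.symm
    · exact hyX h
  rw [ind_of_mem hmem, mul_one]
  unfold rcWeightW weight
  refine mul_pos (Finset.prod_pos fun e _ => ?_) (pow_pos hq _)
  by_cases he : e ∈ ω₁
  · have h1 : ((w e : unitInterval) : ℝ) = 1 := he
    rw [if_pos he]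
    simp only [h1]
    exact one_pos
  · rw [if_neg he]
    have h1 : ((w e : unitInterval) : ℝ) ≠ 1 := he
    have h2 : ((w e : unitInterval) : ℝ) ≤ 1 := (w e).2.2
    simp only
    exact sub_pos.2 (lt_of_le_of_ne h2 h1)

/-! ### The positive correlation of two pairs touching `X`, in `tab` form -/

/-- Pointwise: on `{e open}` the weight is `w e` times the weight with `e` pinned to `1`, on `{e closed}` it is `1 − w e` times
the weight with `e` pinned to `0`. [cite: Grimmett2006, Thm. (3.1)(a)] -/
theorem rcWeightW_split (w : Sym2 V → unitInterval) (q : ℝ) (B : Set V) (e : Sym2 V) (ω : BondConfig V) :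
    rcWeightW w q B ω = if e ∈ ω then (w e : ℝ) * rcWeightW (Function.update w e 1) q B ω
      else (1 - (w e : ℝ)) * rcWeightW (Function.update w e 0) q B ω := by
  rw [rcWeightW_affine w q B e ω]
  by_cases he : e ∈ ω
  · rw [if_pos he, rcWeightW_eq_zero_of_zero_mem (Function.update w e 0) q B (by simp) he]; ring
  · rw [if_neg he, rcWeightW_eq_zero_of_one_not_mem (Function.update w e 1) q B (by simp) he]; ring

/-- **Two pairs touching `X` are positively correlated given avoidance, in `tab` form**: with `e = s(a,b)`, `f = s(c,d)`,
`a, c ∈ X`, `w_{ij} = w[e↦i][f↦j]`:  `b(w₀₁, X∪{d})·b(w₁₀, X∪{b}) ≤ b(w₀₀, X)·b(w₁₁, X∪{b,d})` — the cross-term sign `(PC)` of the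
second Bernstein deformation (bschramm/FK-Q2.md §12.4), from `FK.exitPair_posCorrelation_rc`.
[cite: VandenbergHaggstromKahn2005, Thm. 2.1 (p. 9)] -/
theorem tab_posCorr (w : Sym2 V → unitInterval) {q : ℝ} (hq : 1 ≤ q) {s y : V} (X : Set V) {a b c d : V}
    (ha : a ∈ X) (hab : a ≠ b) (hc : c ∈ X) (hcd : c ≠ d) (hef : s(a, b) ≠ s(c, d))
    (he0 : 0 < ((w s(a, b) : unitInterval) : ℝ)) (he1 : ((w s(a, b) : unitInterval) : ℝ) < 1)
    (hf0 : 0 < ((w s(c, d) : unitInterval) : ℝ)) (hf1 : ((w s(c, d) : unitInterval) : ℝ) < 1) :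
    tab (Function.update (Function.update w s(a, b) 0) s(c, d) 1) q s y (insert d X) *
        tab (Function.update (Function.update w s(a, b) 1) s(c, d) 0) q s y (insert b X) ≤
      tab (Function.update (Function.update w s(a, b) 0) s(c, d) 0) q s y X *
        tab (Function.update (Function.update w s(a, b) 1) s(c, d) 1) q s y (insert b (insert d X)) := by
  classical
  have hq0 : 0 < q := one_pos.trans_le hq
  set e : Sym2 V := s(a, b) with he
  set f : Sym2 V := s(c, d) with hf
  have hfe : f ≠ e := fun h => hef h.symm
  set w00 := Function.update (Function.update w e 0) f 0 with hw00
  set w01 := Function.update (Function.update w e 0) f 1 with hw01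
  set w10 := Function.update (Function.update w e 1) f 0 with hw10
  set w11 := Function.update (Function.update w e 1) f 1 with hw11
  have h10e : ((w10 e : unitInterval) : ℝ) = 1 := by simp [hw10, Function.update_of_ne hfe.symm]
  have h11e : ((w11 e : unitInterval) : ℝ) = 1 := by simp [hw11, Function.update_of_ne hfe.symm]
  have h01f : ((w01 f : unitInterval) : ℝ) = 1 := by simp [hw01]
  have h11f : ((w11 f : unitInterval) : ℝ) = 1 := by simp [hw11]
  have h00e : ((w00 e : unitInterval) : ℝ) = 0 := by simp [hw00, Function.update_of_ne hfe.symm]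
  have h01e : ((w01 e : unitInterval) : ℝ) = 0 := by simp [hw01, Function.update_of_ne hfe.symm]
  have h00f : ((w00 f : unitInterval) : ℝ) = 0 := by simp [hw00]
  have h10f : ((w10 f : unitInterval) : ℝ) = 0 := by simp [hw10]
  -- absorption: all four avoided sets become `X`
  rw [tab_absorb w01 q s y c d X hc h01f, tab_absorb w10 q s y a b X ha h10e,
    tab_absorb w11 q s y a b (insert d X) (Set.mem_insert_of_mem _ ha) h11e, tab_absorb w11 q s y c d X hc h11f]
  set D : Set (BondConfig V) := avoidEv y (insert s X) with hD
  set te : ℝ := ((w e : unitInterval) : ℝ) with hte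
  set tf : ℝ := ((w f : unitInterval) : ℝ) with htf
  have hwef : ((Function.update w e 0 f : unitInterval) : ℝ) = tf := by rw [Function.update_of_ne hfe]
  have hwef' : ((Function.update w e 1 f : unitInterval) : ℝ) = tf := by rw [Function.update_of_ne hfe]
  -- the four corner masses `m_{ij} = Σ_ω w_{ij}(ω) 1_D(ω) = tab(w_{ij}, X)`
  set m00 := ∑ ω, rcWeightW w00 q ∅ ω * ind D ω with hm00
  set m01 := ∑ ω, rcWeightW w01 q ∅ ω * ind D ω with hm01
  set m10 := ∑ ω, rcWeightW w10 q ∅ ω * ind D ω with hm10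
  set m11 := ∑ ω, rcWeightW w11 q ∅ ω * ind D ω with hm11
  change m01 * m10 ≤ m00 * m11
  -- pointwise four-term decomposition
  have hpt : ∀ ω : BondConfig V, rcWeightW w q ∅ ω =
      (if e ∈ ω then (if f ∈ ω then te * tf * rcWeightW w11 q ∅ ω else te * (1 - tf) * rcWeightW w10 q ∅ ω)
        else (if f ∈ ω then (1 - te) * tf * rcWeightW w01 q ∅ ω else (1 - te) * (1 - tf) * rcWeightW w00 q ∅ ω)) := by
    intro ω
    rw [rcWeightW_split w q ∅ e ω]
    by_cases heω : e ∈ ω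
    · rw [if_pos heω, if_pos heω, rcWeightW_split (Function.update w e 1) q ∅ f ω, hwef']
      by_cases hfω : f ∈ ω
      · rw [if_pos hfω, if_pos hfω]; ring
      · rw [if_neg hfω, if_neg hfω]; ring
    · rw [if_neg heω, if_neg heω, rcWeightW_split (Function.update w e 0) q ∅ f ω, hwef]
      by_cases hfω : f ∈ ω
      · rw [if_pos hfω, if_pos hfω]; ring
      · rw [if_neg hfω, if_neg hfω]; ring
  -- vanishing of the pinned weights off their cylinders
  have z11 : ∀ ω, ¬ (e ∈ ω ∧ f ∈ ω) → rcWeightW w11 q ∅ ω = 0 := by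
    intro ω h
    by_cases heω : e ∈ ω
    · exact rcWeightW_eq_zero_of_one_not_mem w11 q ∅ h11f (fun hfω => h ⟨heω, hfω⟩)
    · exact rcWeightW_eq_zero_of_one_not_mem w11 q ∅ h11e heω
  have z10 : ∀ ω, ¬ (e ∈ ω ∧ f ∉ ω) → rcWeightW w10 q ∅ ω = 0 := by
    intro ω h
    by_cases heω : e ∈ ω
    · have hfω : f ∈ ω := by by_contra hh; exact h ⟨heω, hh⟩
      exact rcWeightW_eq_zero_of_zero_mem w10 q ∅ h10f hfω
    · exact rcWeightW_eq_zero_of_one_not_mem w10 q ∅ h10e heω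
  have z01 : ∀ ω, ¬ (e ∉ ω ∧ f ∈ ω) → rcWeightW w01 q ∅ ω = 0 := by
    intro ω h
    by_cases heω : e ∈ ω
    · exact rcWeightW_eq_zero_of_zero_mem w01 q ∅ h01e heω
    · exact rcWeightW_eq_zero_of_one_not_mem w01 q ∅ h01f (fun hfω => h ⟨heω, hfω⟩)
  have z00 : ∀ ω, ¬ (e ∉ ω ∧ f ∉ ω) → rcWeightW w00 q ∅ ω = 0 := by
    intro ω h
    by_cases heω : e ∈ ω
    · exact rcWeightW_eq_zero_of_zero_mem w00 q ∅ h00e heω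
    · have hfω : f ∈ ω := by by_contra hh; exact h ⟨heω, hh⟩
      exact rcWeightW_eq_zero_of_zero_mem w00 q ∅ h00f hfω
  -- masses of `D ∩ cylinder` under `w`
  set Oe : Set (BondConfig V) := {ω | e ∈ ω} with hOe
  set Of : Set (BondConfig V) := {ω | f ∈ ω} with hOf
  have hS : ∀ (A : Set (BondConfig V)), (rcMeasureW w q ∅).real A * rcPartitionFunctionW w q ∅ =
      ∑ ω, rcWeightW w q ∅ ω * ind A ω := by
    intro A
    rw [rcMeasureW_real_eq_sum_div w hq0 ∅ A, div_mul_cancel₀ _ (rcPartitionFunctionW_pos w hq0 ∅).ne']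
  -- S(D) = Σ c_ij m_ij, S(D ∩ Oe) = ..., S(D ∩ Of) = ..., S(D ∩ Oe ∩ Of) = ...
  have hSD : ∑ ω, rcWeightW w q ∅ ω * ind D ω =
      te * tf * m11 + te * (1 - tf) * m10 + (1 - te) * tf * m01 + (1 - te) * (1 - tf) * m00 := by
    simp only [hm00, hm01, hm10, hm11, Finset.mul_sum, ← Finset.sum_add_distrib]
    refine Finset.sum_congr rfl fun ω _ => ?_
    rw [hpt ω]
    by_cases heω : e ∈ ω <;> by_cases hfω : f ∈ ω
    · rw [if_pos heω, if_pos hfω, z10 ω (fun h => h.2 hfω), z01 ω (fun h => h.1 heω), z00 ω (fun h => h.1 heω)]; ring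
    · rw [if_pos heω, if_neg hfω, z11 ω (fun h => hfω h.2), z01 ω (fun h => h.1 heω), z00 ω (fun h => h.1 heω)]; ring
    · rw [if_neg heω, if_pos hfω, z11 ω (fun h => heω h.1), z10 ω (fun h => heω h.1), z00 ω (fun h => h.2 hfω)]; ring
    · rw [if_neg heω, if_neg hfω, z11 ω (fun h => heω h.1), z10 ω (fun h => heω h.1), z01 ω (fun h => hfω h.2)]; ring
  have hSDe : ∑ ω, rcWeightW w q ∅ ω * ind (D ∩ Oe) ω = te * tf * m11 + te * (1 - tf) * m10 := by
    simp only [hm10, hm11, Finset.mul_sum, ← Finset.sum_add_distrib]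
    refine Finset.sum_congr rfl fun ω _ => ?_
    by_cases heω : e ∈ ω
    · have hind : ind (D ∩ Oe) ω = ind D ω := by
        by_cases hDω : ω ∈ D
        · rw [ind_of_mem hDω, ind_of_mem (Set.mem_inter hDω heω)]
        · rw [ind_of_not_mem hDω, ind_of_not_mem fun h => hDω h.1]
      rw [hind, hpt ω, if_pos heω]
      by_cases hfω : f ∈ ω
      · rw [if_pos hfω, z10 ω (fun h => h.2 hfω)]; ring
      · rw [if_neg hfω, z11 ω (fun h => hfω h.2)]; ring
    · rw [ind_of_not_mem (fun h : ω ∈ D ∩ Oe => heω h.2), z11 ω (fun h => heω h.1), z10 ω (fun h => heω h.1)]; ring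
  have hSDf : ∑ ω, rcWeightW w q ∅ ω * ind (D ∩ Of) ω = te * tf * m11 + (1 - te) * tf * m01 := by
    simp only [hm01, hm11, Finset.mul_sum, ← Finset.sum_add_distrib]
    refine Finset.sum_congr rfl fun ω _ => ?_
    by_cases hfω : f ∈ ω
    · have hind : ind (D ∩ Of) ω = ind D ω := by
        by_cases hDω : ω ∈ D
        · rw [ind_of_mem hDω, ind_of_mem (Set.mem_inter hDω hfω)]
        · rw [ind_of_not_mem hDω, ind_of_not_mem fun h => hDω h.1]
      rw [hind, hpt ω]
      by_cases heω : e ∈ ω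
      · rw [if_pos heω, if_pos hfω, z01 ω (fun h => h.1 heω)]; ring
      · rw [if_neg heω, if_pos hfω, z11 ω (fun h => heω h.1)]; ring
    · rw [ind_of_not_mem (fun h : ω ∈ D ∩ Of => hfω h.2), z11 ω (fun h => hfω h.2), z01 ω (fun h => hfω h.2)]; ring
  have hSDef : ∑ ω, rcWeightW w q ∅ ω * ind (D ∩ Oe ∩ Of) ω = te * tf * m11 := by
    simp only [hm11, Finset.mul_sum]
    refine Finset.sum_congr rfl fun ω _ => ?_
    by_cases hef' : e ∈ ω ∧ f ∈ ω
    · have hind : ind (D ∩ Oe ∩ Of) ω = ind D ω := by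
        by_cases hDω : ω ∈ D
        · rw [ind_of_mem hDω, ind_of_mem (Set.mem_inter (Set.mem_inter hDω hef'.1) hef'.2)]
        · rw [ind_of_not_mem hDω, ind_of_not_mem fun h => hDω h.1.1]
      rw [hind, hpt ω, if_pos hef'.1, if_pos hef'.2]; ring
    · rw [ind_of_not_mem (fun h : ω ∈ D ∩ Oe ∩ Of => hef' ⟨h.1.2, h.2⟩), z11 ω hef']; ring
  -- the measure-level positive correlation
  have hPC := exitPair_posCorrelation_rc w hq y (insert s X) (Set.mem_insert_of_mem _ ha) hab
    (Set.mem_insert_of_mem _ hc) hcd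
  have hDset : {ω : BondConfig V | ∀ t ∈ insert s X, ¬ (openGraph ω).Reachable y t} = D := rfl
  rw [hDset] at hPC
  have hZ := rcPartitionFunctionW_pos w hq0 ∅
  have key : (∑ ω, rcWeightW w q ∅ ω * ind (D ∩ Oe) ω) * (∑ ω, rcWeightW w q ∅ ω * ind (D ∩ Of) ω) ≤
      (∑ ω, rcWeightW w q ∅ ω * ind D ω) * (∑ ω, rcWeightW w q ∅ ω * ind (D ∩ Oe ∩ Of) ω) := by
    rw [← hS D, ← hS (D ∩ Oe), ← hS (D ∩ Of), ← hS (D ∩ Oe ∩ Of)]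
    have := mul_le_mul_of_nonneg_right hPC (mul_nonneg hZ.le hZ.le)
    nlinarith [this]
  rw [hSD, hSDe, hSDf, hSDef] at key
  -- algebra: (c11 m11 + c10 m10)(c11 m11 + c01 m01) ≤ (Σ c m)(c11 m11) ⟺ c10 c01 m10 m01 ≤ c00 c11 m00 m11
  have hte0 : 0 < te := he0
  have hte1 : te < 1 := he1
  have htf0 : 0 < tf := hf0
  have htf1 : tf < 1 := hf1
  have hpos : 0 < te * (1 - tf) * ((1 - te) * tf) := by
    have := sub_pos.2 hte1; have := sub_pos.2 htf1; positivity
  have key2 : te * (1 - tf) * ((1 - te) * tf) * (m01 * m10) ≤ te * (1 - tf) * ((1 - te) * tf) * (m00 * m11) := by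
    nlinarith [key]
  exact le_of_mul_le_mul_left key2 hpos


end DeltaN

end Summit.CriticalPhenomena.PercolationContinuityZ3.Theorems.FK

end
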